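import Literature.AlgebraicGeometry.Frobenioids.KummerReciprocity
import HarnessLib

/-!
# Frobenioids II, Definition 2.2 (ii)(c): transport of the inflation maps along conjugation

Mochizuki, *The geometry of Frobenioids II*, Kyushu J. Math. **62** (2008) 401–460, §2, Definition
2.2 (i)–(ii) p. 17 [cite: MochizukiFrdII2008, Def 2.2 (ii) p.17]: the surjection `H ↠ H_A` is
"well-defined, up to composition with conjugation by an element of `G`", and the conditions of
Def. 2.2 (ii)(c) are "unaffected by composition with conjugation by an element of `G`".

This file PROVES the functoriality behind that remark for the continuous-cohomology rendering of
`KummerReciprocity.lean`: if `(K, q : H → K, X)` and `(K', q' : H → K', X')` are related by mutually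
inverse continuous homomorphisms `e : K ⇄ K' : e'` with `q' = e ∘ q` and mutually inverse coefficient
maps `f : res_e X' → X`, `f' : res_{e'} X → X'` (`InflTransport`), then the maps
`Hⁿ(K, X) → Hⁿ(H, X)` and `Hⁿ(K', X') → Hⁿ(H, X')` along `q`, `q'` (Mathlib
`ContinuousCohomology.map`) sit in a commutative square whose other two sides are bijections, so
one is bijective (resp. surjective) iff the other is (`InflTransport.bijective_iff`,
`InflTransport.surjective_iff`). Everything here is proved; no definition of [FrdII] is restated;
the specialisation to conjugation inside `Aut_E(A_E)` and the discharge of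
`PadicKummer.SaturationConjugationInvariant` are in the companion proofs file.
-/

namespace Literature.AlgebraicGeometry.Frobenioids

namespace Kummer

open CategoryTheory

universe u v

section Transport

variable {k : Type u} [Ring k] [TopologicalSpace k]
variable {K K' H : Type v} [Group K] [TopologicalSpace K] [IsTopologicalGroup K]
  [Group K'] [TopologicalSpace K'] [IsTopologicalGroup K']
  [Group H] [TopologicalSpace H] [IsTopologicalGroup H]

/-! ### Congruence lemmas for `ContinuousCohomology.map` -/

/-- `ContinuousCohomology.map` along equal group homomorphisms and pointwise equal coefficient
morphisms agree. [cite: MochizukiFrdII2008, Def 2.2 (ii) p.17] -/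
theorem contMap_congr {X : TopRep k K} {Y : TopRep k H} {φ ψ : H →ₜ* K} (h : φ = ψ)
    (f : TopRep.res (φ : H →* K) X ⟶ Y) (g : TopRep.res (ψ : H →* K) X ⟶ Y)
    (hfg : ∀ x, f.hom x = g.hom x) (n : ℕ) :
    ContinuousCohomology.map φ f n = ContinuousCohomology.map ψ g n := by
  subst h
  have : f = g := TopRep.hom_ext (ContIntertwiningMap.ext (ContinuousLinearMap.ext hfg))
  rw [this]

/-- The map induced by the identity of the group and a pointwise-identity coefficient morphism is
the identity (the tree's `continuousCohomology_map_eq_id`,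
`Literature/NumberTheory/GaloisRepresentations/CohomologicalDimension.lean`, restated to avoid the
import). [cite: MochizukiFrdII2008, Def 2.2 (ii) p.17] -/
theorem contMap_eq_id {X : TopRep k K} (θ : K →ₜ* K) (F : TopRep.res (θ : K →* K) X ⟶ X)
    (hθ : θ = ContinuousMonoidHom.id K) (hF : ∀ x : X, F.hom x = x) (n : ℕ) :
    ContinuousCohomology.map θ F n = 𝟙 _ := by
  subst hθ
  have : F = 𝟙 X :=
    TopRep.hom_ext (ContIntertwiningMap.ext (ContinuousLinearMap.ext fun x => hF x))
  rw [this]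
  exact ContinuousCohomology.map_id X n

/-! ### Transport data and the commutative square -/

/-- Transport data between `(q : H → K, X)` and `(q' : H → K', X')`: an isomorphism of topological
groups `e : K ⇄ K' : e'` under which `q' = e ∘ q`, and mutually inverse coefficient maps
`f : res_e X' → X`, `f' : res_{e'} X → X'`. [cite: MochizukiFrdII2008, Def 2.2 (ii) p.17] -/
structure InflTransport (q : H →ₜ* K) (q' : H →ₜ* K') (X : TopRep k K) (X' : TopRep k K') where
  /-- `K → K'` -/
  e : K →ₜ* K'
  /-- `K' → K` -/
  e' : K' →ₜ* K
  e'_e : ∀ x, e' (e x) = x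
  e_e' : ∀ x, e (e' x) = x
  q'_eq : ∀ h, q' h = e (q h)
  /-- coefficient map over `e` -/
  f : TopRep.res (e : K →* K') X' ⟶ X
  /-- coefficient map over `e'` -/
  f' : TopRep.res (e' : K' →* K) X ⟶ X'
  f'_f : ∀ x, f'.hom (f.hom x) = x
  f_f' : ∀ x, f.hom (f'.hom x) = x

namespace InflTransport

variable {q : H →ₜ* K} {q' : H →ₜ* K'} {X : TopRep k K} {X' : TopRep k K'}
  (T : InflTransport q q' X X')

/-- The comparison `Hⁿ(K', X') → Hⁿ(K, X)`. [cite: MochizukiFrdII2008, Def 2.2 (ii) p.17] -/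
noncomputable def alpha (n : ℕ) : continuousCohomology n X' ⟶ continuousCohomology n X :=
  ContinuousCohomology.map T.e T.f n

/-- Its inverse `Hⁿ(K, X) → Hⁿ(K', X')`. [cite: MochizukiFrdII2008, Def 2.2 (ii) p.17] -/
noncomputable def beta (n : ℕ) : continuousCohomology n X ⟶ continuousCohomology n X' :=
  ContinuousCohomology.map T.e' T.f' n

omit [IsTopologicalGroup H] in
/-- `α ≫ β = 𝟙`. [cite: MochizukiFrdII2008, Def 2.2 (ii) p.17] -/
theorem alpha_beta (n : ℕ) : T.alpha n ≫ T.beta n = 𝟙 _ := by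
  rw [alpha, beta, ← ContinuousCohomology.map_comp]
  exact contMap_eq_id _ _ (ContinuousMonoidHom.ext fun x => T.e_e' x) (fun x => T.f'_f x) n

omit [IsTopologicalGroup H] in
/-- `β ≫ α = 𝟙`. [cite: MochizukiFrdII2008, Def 2.2 (ii) p.17] -/
theorem beta_alpha (n : ℕ) : T.beta n ≫ T.alpha n = 𝟙 _ := by
  rw [alpha, beta, ← ContinuousCohomology.map_comp]
  exact contMap_eq_id _ _ (ContinuousMonoidHom.ext fun x => T.e'_e x) (fun x => T.f_f' x) n

omit [IsTopologicalGroup H] in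
/-- `α` is bijective. [cite: MochizukiFrdII2008, Def 2.2 (ii) p.17] -/
theorem alpha_bijective (n : ℕ) : Function.Bijective (T.alpha n).hom := by
  refine Function.bijective_iff_has_inverse.mpr ⟨(T.beta n).hom, fun x => ?_, fun x => ?_⟩
  · have h := congr_arg (fun φ => φ.hom x) (T.alpha_beta n)
    simpa using h
  · have h := congr_arg (fun φ => φ.hom x) (T.beta_alpha n)
    simpa using h

/-- The coefficient map `f` read over `H`: `res_{id} (res_{q'} X') → res_q X`.
[cite: MochizukiFrdII2008, Def 2.2 (ii) p.17] -/
def fH : TopRep.res ((ContinuousMonoidHom.id H : H →ₜ* H) : H →* H)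
      (TopRep.res (q' : H →* K') X') ⟶ TopRep.res (q : H →* K) X :=
  TopRep.ofHom
    { toContinuousLinearMap := T.f.hom.toContinuousLinearMap
      isIntertwining' := fun h => by
        have := T.f.hom.isIntertwining' (q h)
        change T.f.hom.toContinuousLinearMap ∘L X'.ρ (q' h) = X.ρ (q h) ∘L _
        rw [T.q'_eq h]
        exact this }

/-- Its inverse `res_{id} (res_q X) → res_{q'} X'`. [cite: MochizukiFrdII2008, Def 2.2 (ii) p.17] -/
def fH' : TopRep.res ((ContinuousMonoidHom.id H : H →ₜ* H) : H →* H)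
      (TopRep.res (q : H →* K) X) ⟶ TopRep.res (q' : H →* K') X' :=
  TopRep.ofHom
    { toContinuousLinearMap := T.f'.hom.toContinuousLinearMap
      isIntertwining' := fun h => by
        have := T.f'.hom.isIntertwining' (q' h)
        change T.f'.hom.toContinuousLinearMap ∘L X.ρ (q h) = X'.ρ (q' h) ∘L _
        have e : q h = T.e' (q' h) := by rw [T.q'_eq h, T.e'_e]
        rw [e]
        exact this }

/-- The comparison `Hⁿ(H, X') → Hⁿ(H, X)` (coefficients restricted along `q'`, `q`).
[cite: MochizukiFrdII2008, Def 2.2 (ii) p.17] -/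
noncomputable def delta (n : ℕ) :
    continuousCohomology n (TopRep.res (q' : H →* K') X') ⟶
      continuousCohomology n (TopRep.res (q : H →* K) X) :=
  ContinuousCohomology.map (ContinuousMonoidHom.id H) T.fH n

/-- Its inverse. [cite: MochizukiFrdII2008, Def 2.2 (ii) p.17] -/
noncomputable def delta' (n : ℕ) :
    continuousCohomology n (TopRep.res (q : H →* K) X) ⟶
      continuousCohomology n (TopRep.res (q' : H →* K') X') :=
  ContinuousCohomology.map (ContinuousMonoidHom.id H) T.fH' n

omit [IsTopologicalGroup K] [IsTopologicalGroup K'] in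
/-- `δ` is bijective. [cite: MochizukiFrdII2008, Def 2.2 (ii) p.17] -/
theorem delta_bijective (n : ℕ) : Function.Bijective (T.delta n).hom := by
  have h1 : T.delta n ≫ T.delta' n = 𝟙 _ := by
    rw [delta, delta', ← ContinuousCohomology.map_comp]
    exact contMap_eq_id ((ContinuousMonoidHom.id H).comp (ContinuousMonoidHom.id H))
      ((TopRep.resFunctor ((ContinuousMonoidHom.id H : H →ₜ* H) : H →* H)).map T.fH ≫ T.fH')
      (ContinuousMonoidHom.ext fun _ => rfl) (fun x => T.f'_f x) n
  have h2 : T.delta' n ≫ T.delta n = 𝟙 _ := by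
    rw [delta, delta', ← ContinuousCohomology.map_comp]
    exact contMap_eq_id ((ContinuousMonoidHom.id H).comp (ContinuousMonoidHom.id H))
      ((TopRep.resFunctor ((ContinuousMonoidHom.id H : H →ₜ* H) : H →* H)).map T.fH' ≫ T.fH)
      (ContinuousMonoidHom.ext fun _ => rfl) (fun x => T.f_f' x) n
  refine Function.bijective_iff_has_inverse.mpr ⟨(T.delta' n).hom, fun x => ?_, fun x => ?_⟩
  · have h := congr_arg (fun φ => φ.hom x) h1
    simpa using h
  · have h := congr_arg (fun φ => φ.hom x) h2
    simpa using h

/-- **The commutative square**: `(Hⁿ(K', X') → Hⁿ(H, X')) ≫ δ = α ≫ (Hⁿ(K, X) → Hⁿ(H, X))`.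
[cite: MochizukiFrdII2008, Def 2.2 (ii) p.17] -/
theorem square (n : ℕ) :
    ContinuousCohomology.map q' (𝟙 _) n ≫ T.delta n =
      T.alpha n ≫ ContinuousCohomology.map q (𝟙 _) n := by
  rw [delta, alpha, ← ContinuousCohomology.map_comp, ← ContinuousCohomology.map_comp]
  exact contMap_congr (φ := q'.comp (ContinuousMonoidHom.id H)) (ψ := T.e.comp q)
    (ContinuousMonoidHom.ext fun h => T.q'_eq h) _ _ (fun x => rfl) n

include T in
/-- Transport of bijectivity of the inflation maps. [cite: MochizukiFrdII2008, Def 2.2 (ii) p.17] -/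
theorem bijective_iff (n : ℕ) :
    Function.Bijective (ContinuousCohomology.map q (𝟙 (TopRep.res (q : H →* K) X)) n).hom ↔
      Function.Bijective
        (ContinuousCohomology.map q' (𝟙 (TopRep.res (q' : H →* K') X')) n).hom := by
  have hsq : (T.delta n).hom ∘ (ContinuousCohomology.map q' (𝟙 _) n).hom =
      (ContinuousCohomology.map q (𝟙 _) n).hom ∘ (T.alpha n).hom := by
    funext x
    have h := congr_arg (fun φ => φ.hom x) (T.square n)
    simpa using h
  rw [← Function.Bijective.of_comp_iff _ (T.alpha_bijective n), ← hsq,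
    Function.Bijective.of_comp_iff' (T.delta_bijective n)]

include T in
/-- Transport of surjectivity of the inflation maps. [cite: MochizukiFrdII2008, Def 2.2 (ii) p.17] -/
theorem surjective_iff (n : ℕ) :
    Function.Surjective (ContinuousCohomology.map q (𝟙 (TopRep.res (q : H →* K) X)) n).hom ↔
      Function.Surjective
        (ContinuousCohomology.map q' (𝟙 (TopRep.res (q' : H →* K') X')) n).hom := by
  have hsq : (T.delta n).hom ∘ (ContinuousCohomology.map q' (𝟙 _) n).hom =
      (ContinuousCohomology.map q (𝟙 _) n).hom ∘ (T.alpha n).hom := by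
    funext x
    have h := congr_arg (fun φ => φ.hom x) (T.square n)
    simpa using h
  rw [← Function.Surjective.of_comp_iff _ (T.alpha_bijective n).surjective, ← hsq,
    Function.Surjective.of_comp_iff' (T.delta_bijective n)]

end InflTransport

end Transport

end Kummer

end Literature.AlgebraicGeometry.Frobenioids
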